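import Summits.QuantumFields.BalabanUV.Beta.D1BFx.PackedColumnJetMass

/-!
# `BalabanUV.Beta.D1BFx.PackedColumnBlockTotalMass` — road «BF-x» for binder row D1, slot (K), the [M] mass rows in the shape ruled R-D1-g43-1 (M-b): **THE
# PACKED-VERTEX ROW FROM BLOCK-TOTAL LETTERS — A FAMILY WHOSE `u`-CENTRED WEIGHTED MASSES HAVE BLOCK TOTALS `Σ_{b ∈ box 4 n} M(n•y′ + b) ≤ n⁴·m̄` SUPERPOSES
# WITH THE ROAD's `Π_bm`-GAUGED PACKED WEIGHTS `colH (G₀^{bm} r) n` (ANY in-block root `r`) TO A KERNEL OF CENTRED WEIGHTED MASS `≤ 4·C_{G₀}·e^{κ′∕2}·Zl 4 (κ′∕8)·m̄`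
# — POWER `n⁰`** (§1 is GENERIC in the weight: any `ℓ¹`-exponential envelope, any dimension — the weights-side half of (M-b) is PIN-AGNOSTIC; §2 is the road's
# own weight family «G0-COL-ENV»; the (III′) literal's `colH (GcombSh n 0)` twin is the companion `CombColumnJetMassBlockTotal`; UNCONDITIONAL)

HONEST DEPENDENCY (cell records, verbatim): «continuum YM on T⁴ ⇐ BetaPertH ∧ nine spine estimates (0/9 proved); BetaPertH ⇐ (D1) ∧ (D4) ∧
CAP+tail; G-an2-4 gates asym, D1 and NE2/3/4.»  HONEST FRAMING (cell contract, verbatim): «discharging `BetaPertH` makes Bałaban's UV stability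
UNCONDITIONAL — a real constructive-QFT result; it is NOT the continuum limit and NOT the Clay problem.»  THIS MODULE DISCHARGES NOTHING of the
wall: [folklore] `ℓ¹` bookkeeping BY NAME over «G0-COL-ENV» (`PackedColumnEnvelope.abs_colH_G₀_road_le`, this lineage, g53), d1-leaf-04's generic mass
lemmas (`RestJetBlockMass.stencil_mass_recentre` ∕ `mass_sum_wsum_le`), the block regrouping of an absolutely convergent lattice sum
(`KKTFluctuationEnergy.tsum_blocks ∕ summable_blocks`), the block index ∕ offset of a site (`AveragingContours.blk_add_off ∕ off_mem_box`) and an2's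
`ExpKernelCalculus` lattice constants.  Every mass letter of the superposed family is a DISPLAYED hypothesis on an ARBITRARY family; nothing about
Bałaban's (or an1's ∕ an3's) tables is asserted.  No definition, no `def … : Prop`, nothing cited, 0 sorry.  NO (1.22) unit row is proved here.  0 root-level
binders of row D1 discharged (hW ∕ hR-sockets ∕ hSX-socket ∕ D1Tel ∕ D1Rep = 0); (J1)∕[W] OPEN; (K) NOT closed; NOT D1, NOT `BetaPertH`, NOT continuum, NOT Clay.

ABSOLUTE RULE (cell charter, verbatim): «No internally-minted statement may enter as a cited fact. Every hypothesis is either kernel-proved in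
this package or a verbatim quotation of a PUBLISHED theorem with page reference. The manuscript(s) under audit are NOT citable for their own
disputed steps — they are the thing under adjudication; programme-internal (2001/route/tribunal) claims are never citable.»

WHY (row OWNER an2 g43 RULING R-D1-g43-1 (M-a)(M-b)(M-d), journal; d1-leaf-01 g27 NOTE N-1 (c), journal; road OWNER d1-p2 g21 `J1-WORD-LIST.md` §3 [M] and g22
LOCATED FINDING F-g22-1 §4 (P-hyb): «[M] in your (M-a)(M-b) shapes with weights `colH (G₀^{bm} ctr)`»).  The END's (L1-M) letter asks a k-free PER-SLOT sup of
the `u`-centred weighted block masses of the literal's first stencils `S (Lc^k) κ u`.  For the RAW covariance blocks (fm ∕ mf, unit `n⁸∕2 × symVhKerAt`)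
d1-leaf-01's exact small-`n` counts of OUR object show the worst slot — the spine root's own bond — carries `≍ n` in the block unit (d = 2: `≈ 0.44·n + 0.4`;
d = 3: `≈ 0.35·n`), while the typical slot is `O(1)` and the slot-AVERAGED mass is flat: the per-slot sup is NOT k-free and no letter SHAPE is bet on a
favourable count.  The ruling therefore asks the fm ∕ mf rows of the PACKED VERTEX per coarse bond `(μ, y)` directly, k-free, block units, with the table
author supplying the BLOCK-TOTAL covariance mass as a closed-form COUNT.  This file is the weights-side half, written ONCE for every pin under discussion
(F-g22-1 Q-g22-1): §1 sees only an envelope `|w u| ≤ W·e^{−ρ|u − n•y|₁}`, so it serves the road's `colH (G₀^{bm} r)` ((P-hyb), (P-γ); §2 here, any root — the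
hybrid pin's `r = ctrOff 4 n` included) and the literal's `colH (GcombSh n 0)` ((P-N′), R-D1-g43-1 (i) as first ruled; the companion file) alike.  The mechanism:
the packed weights are FLAT across a block («G0-COL-ENV»: `≤ (n⁴)⁻¹·C_{G₀}·e^{−(κ′∕(4n))|u − n•y|₁}`), so after the recentring `u ↦ n•y` (cost `e^{2σ|u − n•y|₁}`,
`2σ ≤ κ′∕(8n)` absorbed by half the envelope's rate) the weight sees only the block TOTALS of the family's masses: regroup the absolutely convergent `u`-sum
by coarse blocks `u = n•y′ + b`, pay the in-block offset `|b|₁ ≤ 4n` once per block (`e^{κ′∕2}` at rate `κ′∕(8n)`), bound each block's total by `n⁴·m̄`, sum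
the coarse exponential `e^{−(κ′∕8)|y′ − y|₁}` (`Zl 4 (κ′∕8)`): `(n⁴)⁻¹·C_{G₀} × n⁴·m̄ × e^{κ′∕2}·Zl 4 (κ′∕8)` per direction, four directions — POWER `n⁰`, k-free
on the scales `n = Lc^k` whenever the slot-averaged letter `m̄` is.  `n = m + 1`, `κ′ = kappa163 4 ∕ 4`,
`C_{G₀} = (MG163 4·periodConst (kappa163 4) 3)·(1 + 8(1 + e^{κ′}))·e^{κ′}`.

CONTENT (all [folklore]).
* §1 GENERIC (any dimension `D`, block side `n ≥ 1`): `l1_toSite_le_of_mem_box` (`|b|₁ ≤ D·n` on the box), `exp_block_offset_le` (the in-block offset costs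
  `e^{ρ·D·n}` and leaves the coarse rate `ρ·n`), **`tsum_abs_mul_le_of_blockTotal`** — a weight with an `ℓ¹`-exponential envelope `|w u| ≤ W·e^{−ρ|u − n•y|₁}`
  against a slot function `m ≥ 0` with block totals `Σ_{b ∈ box D n} m (n•y′ + b) ≤ T`: `Σ'_u |w u|·m u ≤ W·e^{ρ·D·n}·Zl D (ρ·n)·T`, summable.
* §2 `d = 3`, the road's gauged packed weights at any in-block root `r`: **`tsum_abs_colH_G₀_mul_le_of_blockTotal`**
  (`Σ'_u |colH (G₀^{bm} r) n μ y κ u|·(M u·e^{2σ|u − n•y|₁}) ≤ (n⁴)⁻¹·C_{G₀}·e^{κ′∕2}·Zl 4 (κ′∕8)·T` for `σ ≤ κ′∕(16n)` and block totals of `M ≥ 0` `≤ T`);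
  **`mass_sum_wsum_colH_G₀_le_of_blockTotal`** (ANY fibre `F`: per-slot summability of the family's `u`-centred weighted masses + their block totals `≤ n⁴·m̄T`
  ⟹ `Σ_κ wsum (colH G₀ n μ y κ) (T κ)` has centred weighted mass at `n•y`, rate `σ`, `≤ 4·C_{G₀}·e^{κ′∕2}·Zl 4 (κ′∕8)·m̄T`); **`mass_blk_vertexOfK_G₀_le_of_blockTotal`**
  — THE (M-b) SHAPE: every block of `vertexOfK (G₀^{bm} r) n S μ y` has centred weighted mass at `n•y`, rate `σ`, `≤ 4·C_{G₀}·e^{κ′∕2}·Zl 4 (κ′∕8)·m̄S j k` from the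
  pack's per-slot summability and its BLOCK-TOTAL letters `Σ_{b ∈ box 4 n} (mass of blk (S κ (n•y′ + b)) j k) ≤ n⁴·m̄S j k` (`PackedColumnJetMass.blk_vertexOfK` BY NAME)
  — the block-total companion of g53's per-slot `PackedColumnJetMass.mass_blk_vertexOfK_G₀_le` (`4·C_{G₀}·(1 + 16∕κ′)⁴·mS j k`).
NOT HERE (honest): the block-total letters themselves (the table author's count ∕ d1-leaf-01's (L1-M) lane); the `GcombSh` twin (companion file); the
pack-level façade (`SN`, co-frame letter — `PackedRoadJetRows`' pattern); the pair ∕ table currency; any (1.22) row; PART 23 (the road OWNER's, pin pending Q-g22-1).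
Unit `b2b-balaban-gan24-formalise-leaf-05` (gen 57), G-an2-4 swarm leaf prover 05, road «BF-x» supplier; INTENT «GCOMB-JET-MASS» ∕ A-2 (journal).
-/

noncomputable section

open Finset
open scoped BigOperators
open Literature.MathematicalPhysics.QuantumFieldTheory.Balaban1983to89
open Literature.MathematicalPhysics.QuantumFieldTheory.Balaban1983to89.Beta
open B12Sec2to5 (l1 l1_nonneg)
open B5Hk163Strip (kappa163 kappa163_pos)
open B5Hk163Decay (MG163)
open B4TorusKernel (periodConst)
open ExpKernelCalculus (Site MKer Zl Zl_pos Zl_nonneg tsum_exp_shift' summable_exp_shift' l1_natSmul l1_sub_triangle l1_sub_symm)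
open AffineAveraging (box toSite)
open AveragingContours (off off_mem_box blk_add_off)
open KKTFluctuationEnergy (tsum_blocks summable_blocks)
open OneStepResolventKernel (Fib wsum)
open OneStepKernelFamily (colH KInvStep vertexOfK)
open Summit.QuantumFields.BalabanUV.Beta.AxialDressingRooted (coDressKBmAt)
open Summit.QuantumFields.BalabanUV.Beta.D1BFx.PackedKernelSplit (blk)
open Summit.QuantumFields.BalabanUV.Beta.D1BFx.RestJetBlockMass (stencil_mass_recentre mass_sum_wsum_le)
open Summit.QuantumFields.BalabanUV.Beta.D1BFx.PackedColumnEnvelope (abs_colH_G₀_road_le colH_G₀_road_weight_nonneg)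
open Summit.QuantumFields.BalabanUV.Beta.D1BFx.PackedColumnJetMass (blk_vertexOfK)

namespace Summit.QuantumFields.BalabanUV.Beta.D1BFx.PackedColumnBlockTotalMass

/-! ## §1 Generic: an `ℓ¹`-exponential envelope against a slot function with bounded block totals -/

section Generic

/-- [folklore] A box point has `ℓ¹`-norm at most `D·n` (each of its `D` coordinates lies in `[0, n)`). -/
theorem l1_toSite_le_of_mem_box {D n : ℕ} {b : Fin D → ℕ} (hb : b ∈ box D n) : l1 (toSite b) ≤ (D : ℝ) * (n : ℝ) := by
  unfold B12Sec2to5.l1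
  have h : ∀ i, |((toSite b i : ℤ) : ℝ)| ≤ (n : ℝ) := fun i => by
    have hi : b i < n := by
      have h' := hb; simp only [AffineAveraging.box, Fintype.mem_piFinset, Finset.mem_range] at h'; exact h' i
    rw [show ((toSite b i : ℤ) : ℝ) = ((b i : ℕ) : ℝ) by simp [toSite], abs_of_nonneg (by positivity)]
    exact_mod_cast hi.le
  calc (∑ i : Fin D, |((toSite b i : ℤ) : ℝ)|) ≤ ∑ _i : Fin D, (n : ℝ) := Finset.sum_le_sum fun i _ => h i
    _ = (D : ℝ) * (n : ℝ) := by rw [Finset.sum_const, Finset.card_univ, Fintype.card_fin, nsmul_eq_mul]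

/-- [folklore] **THE IN-BLOCK OFFSET COSTS `e^{ρ·D·n}` AND LEAVES THE COARSE RATE `ρ·n`**: for `0 ≤ ρ`, a coarse site `y′`, a box point `b` and a centre `n•y`,
`e^{−ρ|n•y′ + b − n•y|₁} ≤ e^{ρ·D·n}·e^{−(ρ·n)|y′ − y|₁}` (`n|y′ − y|₁ = |n•y′ − n•y|₁ ≤ |b|₁ + |n•y′ + b − n•y|₁`, `|b|₁ ≤ D·n`). -/
theorem exp_block_offset_le {D n : ℕ} {ρ : ℝ} (hρ : 0 ≤ ρ) (y y' : Fin D → ℤ) {b : Fin D → ℕ} (hb : b ∈ box D n) :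
    Real.exp (-ρ * l1 ((n : ℤ) • y' + toSite b - (n : ℤ) • y)) ≤ Real.exp (ρ * (D : ℝ) * (n : ℝ)) * Real.exp (-(ρ * (n : ℝ)) * l1 (y' - y)) := by
  rw [← Real.exp_add]
  refine Real.exp_le_exp.2 ?_
  set u : Fin D → ℤ := (n : ℤ) • y' + toSite b with hu
  have t : l1 ((n : ℤ) • y' - (n : ℤ) • y) ≤ l1 ((n : ℤ) • y' - u) + l1 (u - (n : ℤ) • y) := l1_sub_triangle _ u _
  have e1 : l1 ((n : ℤ) • y' - (n : ℤ) • y) = (n : ℝ) * l1 (y' - y) := by rw [← smul_sub, l1_natSmul]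
  have e2 : l1 ((n : ℤ) • y' - u) = l1 (toSite b) := by
    rw [l1_sub_symm, hu, add_sub_cancel_left]
  rw [e1, e2] at t
  have hb' := l1_toSite_le_of_mem_box hb
  nlinarith [hb', t, hρ, l1_nonneg (y' - y)]

/-- [folklore] **A WEIGHT WITH AN `ℓ¹`-EXPONENTIAL ENVELOPE AGAINST A SLOT FUNCTION WITH BOUNDED BLOCK TOTALS** (GENERIC; any dimension `D`, block side `n ≥ 1`):
if `|w u| ≤ W·e^{−ρ|u − n•y|₁}` (`0 < ρ`, `0 ≤ W`) and `m ≥ 0` has block totals `Σ_{b ∈ box D n} m (n•y′ + b) ≤ T` for every coarse block `y′`, then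
`Σ'_u |w u|·m u ≤ W·e^{ρ·D·n}·Zl D (ρ·n)·T` and the series is summable — regroup the absolutely convergent sum by blocks (`KKTFluctuationEnergy.tsum_blocks`),
pay the in-block offset once per block (`exp_block_offset_le`), sum the block totals against the coarse exponential (`tsum_exp_shift'`).  The envelope is
FLAT across a block up to `e^{ρ·D·n}`, so only the block TOTALS of `m` are seen — never its per-slot sup. -/
theorem tsum_abs_mul_le_of_blockTotal {D n : ℕ} [NeZero n] {w m : (Fin D → ℤ) → ℝ} {W ρ T : ℝ} (y : Fin D → ℤ) (hρ : 0 < ρ) (hW : 0 ≤ W)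
    (hw : ∀ u, |w u| ≤ W * Real.exp (-ρ * l1 (u - (n : ℤ) • y))) (hm0 : ∀ u, 0 ≤ m u)
    (hmB : ∀ y' : Fin D → ℤ, ∑ b ∈ box D n, m ((n : ℤ) • y' + toSite b) ≤ T) :
    (Summable fun u : Fin D → ℤ => |w u| * m u) ∧
      ∑' u : Fin D → ℤ, |w u| * m u ≤ W * Real.exp (ρ * (D : ℝ) * (n : ℝ)) * Zl D (ρ * (n : ℝ)) * T := by
  have hn1 : 1 ≤ n := Nat.one_le_iff_ne_zero.mpr (NeZero.ne n)
  have hn0 : (0 : ℝ) < (n : ℝ) := by exact_mod_cast Nat.pos_of_ne_zero (NeZero.ne n)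
  -- a single slot is one term of its block total
  have hmT : ∀ u, m u ≤ T := fun u => by
    have hu : (n : ℤ) • AveragingContours.blk n u + toSite (off n u) = u := blk_add_off hn1 u
    have h1 : m ((n : ℤ) • AveragingContours.blk n u + toSite (off n u))
        ≤ ∑ b ∈ box D n, m ((n : ℤ) • AveragingContours.blk n u + toSite b) :=
      Finset.single_le_sum (f := fun b => m ((n : ℤ) • AveragingContours.blk n u + toSite b)) (fun _ _ => hm0 _) (off_mem_box hn1 u)
    rw [hu] at h1
    exact h1.trans (hmB _)
  have hT : 0 ≤ T := (hm0 0).trans (hmT 0)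
  -- fine summability from the envelope
  have hmaj : ∀ u, |w u| * m u ≤ W * T * Real.exp (-ρ * l1 (u - (n : ℤ) • y)) := fun u =>
    calc |w u| * m u ≤ (W * Real.exp (-ρ * l1 (u - (n : ℤ) • y))) * T := mul_le_mul (hw u) (hmT u) (hm0 u) (by positivity)
      _ = W * T * Real.exp (-ρ * l1 (u - (n : ℤ) • y)) := by ring
  have hnn : ∀ u, 0 ≤ |w u| * m u := fun u => mul_nonneg (abs_nonneg _) (hm0 u)
  have hsum : Summable fun u : Fin D → ℤ => |w u| * m u :=
    Summable.of_nonneg_of_le hnn hmaj ((summable_exp_shift' hρ ((n : ℤ) • y)).mul_left (W * T))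
  refine ⟨hsum, ?_⟩
  have hρn : 0 < ρ * (n : ℝ) := mul_pos hρ hn0
  -- per block: the envelope is flat up to `e^{ρ·D·n}`, the slot function enters through its block total
  have hblk : ∀ y' : Fin D → ℤ, ∑ b ∈ box D n, |w ((n : ℤ) • y' + toSite b)| * m ((n : ℤ) • y' + toSite b)
      ≤ W * Real.exp (ρ * (D : ℝ) * (n : ℝ)) * T * Real.exp (-(ρ * (n : ℝ)) * l1 (y' - y)) := by
    intro y'
    have hpt : ∀ b ∈ box D n, |w ((n : ℤ) • y' + toSite b)| * m ((n : ℤ) • y' + toSite b)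
        ≤ (W * Real.exp (ρ * (D : ℝ) * (n : ℝ)) * Real.exp (-(ρ * (n : ℝ)) * l1 (y' - y))) * m ((n : ℤ) • y' + toSite b) := by
      intro b hb
      refine mul_le_mul_of_nonneg_right ?_ (hm0 _)
      calc |w ((n : ℤ) • y' + toSite b)| ≤ W * Real.exp (-ρ * l1 ((n : ℤ) • y' + toSite b - (n : ℤ) • y)) := hw _
        _ ≤ W * (Real.exp (ρ * (D : ℝ) * (n : ℝ)) * Real.exp (-(ρ * (n : ℝ)) * l1 (y' - y))) :=
            mul_le_mul_of_nonneg_left (exp_block_offset_le hρ.le y y' hb) hW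
        _ = W * Real.exp (ρ * (D : ℝ) * (n : ℝ)) * Real.exp (-(ρ * (n : ℝ)) * l1 (y' - y)) := by ring
    calc ∑ b ∈ box D n, |w ((n : ℤ) • y' + toSite b)| * m ((n : ℤ) • y' + toSite b)
        ≤ ∑ b ∈ box D n, (W * Real.exp (ρ * (D : ℝ) * (n : ℝ)) * Real.exp (-(ρ * (n : ℝ)) * l1 (y' - y))) * m ((n : ℤ) • y' + toSite b) :=
          Finset.sum_le_sum hpt
      _ = (W * Real.exp (ρ * (D : ℝ) * (n : ℝ)) * Real.exp (-(ρ * (n : ℝ)) * l1 (y' - y))) * ∑ b ∈ box D n, m ((n : ℤ) • y' + toSite b) := by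
          rw [Finset.mul_sum]
      _ ≤ (W * Real.exp (ρ * (D : ℝ) * (n : ℝ)) * Real.exp (-(ρ * (n : ℝ)) * l1 (y' - y))) * T :=
          mul_le_mul_of_nonneg_left (hmB y') (by positivity)
      _ = W * Real.exp (ρ * (D : ℝ) * (n : ℝ)) * T * Real.exp (-(ρ * (n : ℝ)) * l1 (y' - y)) := by ring
  have hcoarse := (summable_exp_shift' hρn y).mul_left (W * Real.exp (ρ * (D : ℝ) * (n : ℝ)) * T)
  -- regroup the absolutely convergent fine sum by coarse blocks (statements taken from the lemmas, not re-typed)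
  have hblocks := tsum_blocks (N := n) hsum
  have hsb := summable_blocks (N := n) hsum
  rw [hblocks]
  calc ∑' y' : Fin D → ℤ, ∑ b ∈ box D n, |w ((n : ℤ) • y' + toSite b)| * m ((n : ℤ) • y' + toSite b)
      ≤ ∑' y' : Fin D → ℤ, W * Real.exp (ρ * (D : ℝ) * (n : ℝ)) * T * Real.exp (-(ρ * (n : ℝ)) * l1 (y' - y)) :=
        Summable.tsum_le_tsum hblk hsb hcoarse
    _ = W * Real.exp (ρ * (D : ℝ) * (n : ℝ)) * T * Zl D (ρ * (n : ℝ)) := by rw [tsum_mul_left, tsum_exp_shift']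
    _ = W * Real.exp (ρ * (D : ℝ) * (n : ℝ)) * Zl D (ρ * (n : ℝ)) * T := by ring

end Generic

/-! ## §2 `d = 3`: the road's `Π_bm`-gauged packed weights `colH (G₀^{bm} r) n` against block totals — the (M-b) packed-vertex row at ANY in-block root -/

section Packed

variable (m : ℕ) {r : Fin (3 + 1) → ℕ} (hr : r ∈ box (3 + 1) (m + 1))
include hr

/-- [folklore] **ONE `Π_bm`-GAUGED PACKED WEIGHT AGAINST A SLOT FUNCTION WITH BOUNDED BLOCK TOTALS** (any in-block root `r`): for `σ ≤ κ′∕(16n)` (any sign), `M ≥ 0` with block totals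
`Σ_{b ∈ box 4 n} M (n•y′ + b) ≤ T` (every coarse block `y′`), every coarse bond `(μ, y)` and fine direction `κ`:
`Σ'_u |colH (G₀^{bm} r) n μ y κ u|·(M u·e^{2σ|u − n•y|₁}) ≤ (n⁴)⁻¹·C_{G₀}·e^{κ′∕2}·Zl 4 (κ′∕8)·T`, summable («G0-COL-ENV» at rate `κ′∕(4n)`, `2σ ≤ κ′∕(8n)`
absorbed, `tsum_abs_mul_le_of_blockTotal` at `ρ = κ′∕(8n)`: `ρ·4·n = κ′∕2`, `ρ·n = κ′∕8`). -/
theorem tsum_abs_colH_G₀_mul_le_of_blockTotal {σ : ℝ} (hσ : σ ≤ kappa163 4 / 4 / (16 * ((m + 1 : ℕ) : ℝ)))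
    {M : (Fin (3 + 1) → ℤ) → ℝ} {T : ℝ} (hM0 : ∀ u, 0 ≤ M u)
    (hMB : ∀ y' : Fin (3 + 1) → ℤ, ∑ b ∈ box (3 + 1) (m + 1), M (((m + 1 : ℕ) : ℤ) • y' + toSite b) ≤ T)
    (μ : Fin (3 + 1)) (y : Fin (3 + 1) → ℤ) (κ : Fin (3 + 1)) :
    (Summable fun u : Fin (3 + 1) → ℤ => |colH (coDressKBmAt (toSite r) (m + 1) (KInvStep (d := 3) (m + 1) 0)) (m + 1) μ y κ u|
        * (M u * Real.exp (2 * σ * l1 (u - ((m + 1 : ℕ) : ℤ) • y)))) ∧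
      ∑' u : Fin (3 + 1) → ℤ, |colH (coDressKBmAt (toSite r) (m + 1) (KInvStep (d := 3) (m + 1) 0)) (m + 1) μ y κ u|
          * (M u * Real.exp (2 * σ * l1 (u - ((m + 1 : ℕ) : ℤ) • y)))
        ≤ ((((m + 1 : ℕ) : ℝ) ^ 4)⁻¹ * ((MG163 4 * periodConst (kappa163 4) 3)
            * (1 + 8 * (1 + Real.exp (kappa163 4 / 4))) * Real.exp (kappa163 4 / 4)))
          * Real.exp (kappa163 4 / 4 / 2) * Zl 4 (kappa163 4 / 4 / 8) * T := by
  set C : ℝ := (((m + 1 : ℕ) : ℝ) ^ 4)⁻¹ * ((MG163 4 * periodConst (kappa163 4) 3)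
    * (1 + 8 * (1 + Real.exp (kappa163 4 / 4))) * Real.exp (kappa163 4 / 4)) with hC
  have hC0 : 0 ≤ C := colH_G₀_road_weight_nonneg m
  have hn : (0 : ℝ) < ((m + 1 : ℕ) : ℝ) := by exact_mod_cast Nat.succ_pos m
  have hκ := kappa163_pos 4
  set ρ : ℝ := kappa163 4 / 4 / (8 * ((m + 1 : ℕ) : ℝ)) with hρ
  have hρ0 : 0 < ρ := by positivity
  set c : Fin (3 + 1) → ℤ := ((m + 1 : ℕ) : ℤ) • y with hc
  -- the weight `w u := colH … u · e^{2σ|u − c|₁}` has the envelope `C·e^{−ρ|u − c|₁}`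
  have hw : ∀ u : Fin (3 + 1) → ℤ, |colH (coDressKBmAt (toSite r) (m + 1) (KInvStep (d := 3) (m + 1) 0)) (m + 1) μ y κ u * Real.exp (2 * σ * l1 (u - c))|
      ≤ C * Real.exp (-ρ * l1 (u - ((m + 1 : ℕ) : ℤ) • y)) := by
    intro u
    rw [abs_mul, abs_of_pos (Real.exp_pos _), ← hc]
    have h1 := abs_colH_G₀_road_le m hr μ y κ u
    rw [← hc] at h1
    have hl := l1_nonneg (u - c)
    calc |colH (coDressKBmAt (toSite r) (m + 1) (KInvStep (d := 3) (m + 1) 0)) (m + 1) μ y κ u| * Real.exp (2 * σ * l1 (u - c))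
        ≤ (C * Real.exp (-(kappa163 4 / 4 / (4 * ((m + 1 : ℕ) : ℝ))) * l1 (u - c))) * Real.exp (2 * σ * l1 (u - c)) :=
          mul_le_mul_of_nonneg_right h1 (Real.exp_pos _).le
      _ = C * Real.exp (-(kappa163 4 / 4 / (4 * ((m + 1 : ℕ) : ℝ))) * l1 (u - c) + 2 * σ * l1 (u - c)) := by
          rw [Real.exp_add]; ring
      _ ≤ C * Real.exp (-ρ * l1 (u - c)) := by
          refine mul_le_mul_of_nonneg_left (Real.exp_le_exp.2 ?_) hC0
          have e8 : kappa163 4 / 4 / (4 * ((m + 1 : ℕ) : ℝ)) = 2 * ρ := by rw [hρ]; field_simp; ring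
          have e16 : kappa163 4 / 4 / (16 * ((m + 1 : ℕ) : ℝ)) = ρ / 2 := by rw [hρ]; field_simp; ring
          rw [e16] at hσ
          rw [e8]
          nlinarith [hl, hρ0]
  obtain ⟨hs, hb⟩ := tsum_abs_mul_le_of_blockTotal (D := 3 + 1) (n := m + 1)
    (w := fun u => colH (coDressKBmAt (toSite r) (m + 1) (KInvStep (d := 3) (m + 1) 0)) (m + 1) μ y κ u * Real.exp (2 * σ * l1 (u - c))) (m := M)
    y hρ0 hC0 hw hM0 hMB
  have e : (fun u : Fin (3 + 1) → ℤ => |colH (coDressKBmAt (toSite r) (m + 1) (KInvStep (d := 3) (m + 1) 0)) (m + 1) μ y κ u| * (M u * Real.exp (2 * σ * l1 (u - c))))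
      = fun u => |colH (coDressKBmAt (toSite r) (m + 1) (KInvStep (d := 3) (m + 1) 0)) (m + 1) μ y κ u * Real.exp (2 * σ * l1 (u - c))| * M u := by
    funext u
    rw [abs_mul, abs_of_pos (Real.exp_pos _)]; ring
  rw [e]
  refine ⟨hs, hb.trans (le_of_eq ?_)⟩
  have e1 : ρ * (((3 + 1 : ℕ) : ℕ) : ℝ) * (((m + 1 : ℕ)) : ℝ) = kappa163 4 / 4 / 2 := by
    rw [hρ]; push_cast; field_simp; ring
  have e2 : ρ * (((m + 1 : ℕ)) : ℝ) = kappa163 4 / 4 / 8 := by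
    rw [hρ]; field_simp
  rw [e1, e2]

/-- [folklore] **«G0-JET-MASS», SUPERPOSITION FORM, CURRENCY (B)** (ANY fibre `F`, any in-block root): for `0 ≤ σ ≤ κ′∕(16n)` and a family `T κ u : MKer 4 F` whose members have summable
`u`-centred weighted masses `M κ u := Σ'_{(p,q)} Σ_{ab} |T κ u p q a b|·e^{σ(|p − u|₁ + |q − u|₁)}` with BLOCK TOTALS `Σ_{b ∈ box 4 n} M κ (n•y′ + b) ≤ n⁴·m̄T` (every
direction `κ`, every coarse block `y′`), the superposition `Σ_κ wsum (colH (G₀^{bm} r) n μ y κ) (T κ)` has centred weighted mass at `n•y`, rate `σ`, summable and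
`≤ 4·C_{G₀}·e^{κ′∕2}·Zl 4 (κ′∕8)·m̄T` — per slot the recentred letter `M κ u·e^{2σ|u − n•y|₁}` (`stencil_mass_recentre`), per direction
`Σ'_u |colH G₀|·M κ u·e^{2σ|u − n•y|₁} ≤ (n⁴)⁻¹·C_{G₀}·e^{κ′∕2}·Zl 4 (κ′∕8)·(n⁴·m̄T)` (previous lemma), four directions (`mass_sum_wsum_le`).  POWER `n⁰`; only the
block TOTALS of the family's masses are seen (R-D1-g43-1 (M-b): the slot-AVERAGED mass). -/
theorem mass_sum_wsum_colH_G₀_le_of_blockTotal {F : Type*} [Fintype F] {T : Fin (3 + 1) → (Fin (3 + 1) → ℤ) → MKer 4 F} {σ mT : ℝ}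
    (hσ0 : 0 ≤ σ) (hσ : σ ≤ kappa163 4 / 4 / (16 * ((m + 1 : ℕ) : ℝ)))
    (hTs : ∀ κ u, Summable fun p : Site 4 × Site 4 => ∑ a, ∑ b, |T κ u p.1 p.2 a b| * Real.exp (σ * (l1 (p.1 - u) + l1 (p.2 - u))))
    (hTB : ∀ (κ : Fin (3 + 1)) (y' : Fin (3 + 1) → ℤ), ∑ b ∈ box (3 + 1) (m + 1),
      (∑' p : Site 4 × Site 4, ∑ a, ∑ b', |T κ (((m + 1 : ℕ) : ℤ) • y' + toSite b) p.1 p.2 a b'|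
        * Real.exp (σ * (l1 (p.1 - (((m + 1 : ℕ) : ℤ) • y' + toSite b)) + l1 (p.2 - (((m + 1 : ℕ) : ℤ) • y' + toSite b)))))
      ≤ ((m + 1 : ℕ) : ℝ) ^ 4 * mT)
    (μ : Fin (3 + 1)) (y : Fin (3 + 1) → ℤ) :
    (Summable fun p : Site 4 × Site 4 => ∑ a, ∑ b,
        |(∑ κ : Fin (3 + 1), wsum (colH (coDressKBmAt (toSite r) (m + 1) (KInvStep (d := 3) (m + 1) 0)) (m + 1) μ y κ) (T κ)) p.1 p.2 a b|
          * Real.exp (σ * (l1 (p.1 - ((m + 1 : ℕ) : ℤ) • y) + l1 (p.2 - ((m + 1 : ℕ) : ℤ) • y)))) ∧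
      ∑' p : Site 4 × Site 4, ∑ a, ∑ b,
          |(∑ κ : Fin (3 + 1), wsum (colH (coDressKBmAt (toSite r) (m + 1) (KInvStep (d := 3) (m + 1) 0)) (m + 1) μ y κ) (T κ)) p.1 p.2 a b|
            * Real.exp (σ * (l1 (p.1 - ((m + 1 : ℕ) : ℤ) • y) + l1 (p.2 - ((m + 1 : ℕ) : ℤ) • y)))
        ≤ 4 * ((MG163 4 * periodConst (kappa163 4) 3) * (1 + 8 * (1 + Real.exp (kappa163 4 / 4))) * Real.exp (kappa163 4 / 4))
            * Real.exp (kappa163 4 / 4 / 2) * Zl 4 (kappa163 4 / 4 / 8) * mT := by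
  have hn0 : (0 : ℝ) < ((m + 1 : ℕ) : ℝ) := by exact_mod_cast Nat.succ_pos m
  set K₀ : ℝ := (MG163 4 * periodConst (kappa163 4) 3) * (1 + 8 * (1 + Real.exp (kappa163 4 / 4))) * Real.exp (kappa163 4 / 4) with hK₀
  set C : ℝ := (((m + 1 : ℕ) : ℝ) ^ 4)⁻¹ * K₀ with hC
  set Z : ℝ := Real.exp (kappa163 4 / 4 / 2) * Zl 4 (kappa163 4 / 4 / 8) with hZ
  have hC0 : 0 ≤ C := colH_G₀_road_weight_nonneg m
  set c : Site 4 := ((m + 1 : ℕ) : ℤ) • y with hc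
  set W : Site 4 × Site 4 → ℝ := fun p => Real.exp (σ * (l1 (p.1 - c) + l1 (p.2 - c))) with hW
  have hWpos : ∀ p, 0 < W p := fun p => Real.exp_pos _
  -- the slot function: the family's own (summable) weighted masses
  set M : Fin (3 + 1) → (Fin (3 + 1) → ℤ) → ℝ := fun κ u =>
    ∑' p : Site 4 × Site 4, ∑ a, ∑ b, |T κ u p.1 p.2 a b| * Real.exp (σ * (l1 (p.1 - u) + l1 (p.2 - u))) with hM
  have hM0 : ∀ κ u, 0 ≤ M κ u := fun κ u =>
    tsum_nonneg fun p => Finset.sum_nonneg fun a _ => Finset.sum_nonneg fun b _ => by positivity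
  -- per stencil: recentred letter `M κ u·e^{2σ|u − c|₁}`
  have hrec : ∀ κ u, (Summable fun p : Site 4 × Site 4 => ∑ a, ∑ b, |T κ u p.1 p.2 a b| * W p) ∧
      ∑' p : Site 4 × Site 4, ∑ a, ∑ b, |T κ u p.1 p.2 a b| * W p ≤ M κ u * Real.exp (2 * σ * l1 (u - c)) :=
    fun κ u => stencil_mass_recentre hσ0 u c (hTs κ u) le_rfl
  -- per direction: the weight letter against the block totals
  have hw : ∀ κ : Fin (3 + 1),
      (Summable fun u : Site 4 => |colH (coDressKBmAt (toSite r) (m + 1) (KInvStep (d := 3) (m + 1) 0)) (m + 1) μ y κ u| * (M κ u * Real.exp (2 * σ * l1 (u - c)))) ∧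
      ∑' u : Site 4, |colH (coDressKBmAt (toSite r) (m + 1) (KInvStep (d := 3) (m + 1) 0)) (m + 1) μ y κ u| * (M κ u * Real.exp (2 * σ * l1 (u - c)))
        ≤ C * Z * (((m + 1 : ℕ) : ℝ) ^ 4 * mT) := by
    intro κ
    obtain ⟨hs, hb⟩ := tsum_abs_colH_G₀_mul_le_of_blockTotal m hr hσ (M := M κ) (T := ((m + 1 : ℕ) : ℝ) ^ 4 * mT)
      (hM0 κ) (hTB κ) μ y κ
    rw [← hc] at hs hb
    refine ⟨hs, hb.trans (le_of_eq ?_)⟩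
    rw [hC, hZ]; ring
  have hsum := mass_sum_wsum_le (Finset.univ : Finset (Fin (3 + 1)))
    (w := fun κ u => colH (coDressKBmAt (toSite r) (m + 1) (KInvStep (d := 3) (m + 1) 0)) (m + 1) μ y κ u)
    (K := fun κ u => T κ u) (M := fun _ => C * Z * (((m + 1 : ℕ) : ℝ) ^ 4 * mT)) hWpos (fun κ u => (hrec κ u).1)
    (fun κ u => (hrec κ u).2) (fun κ => (hw κ).1) (fun κ => (hw κ).2)
  refine ⟨hsum.1, hsum.2.trans (le_of_eq ?_)⟩
  rw [Finset.sum_const, Finset.card_univ, Fintype.card_fin, nsmul_eq_mul]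
  -- the count: `4·C·Z·(n⁴·m̄T) = 4·K₀·Z·m̄T` (`(n⁴)⁻¹·n⁴ = 1`)
  have hn4 : (((m + 1 : ℕ) : ℝ)) ^ 4 ≠ 0 := by positivity
  have hinv : (((m + 1 : ℕ) : ℝ) ^ 4)⁻¹ * (((m + 1 : ℕ) : ℝ) ^ 4) = 1 := inv_mul_cancel₀ hn4
  have e4 : (((3 + 1 : ℕ) : ℕ) : ℝ) = 4 := by norm_num
  have e1 : (((3 + 1 : ℕ) : ℕ) : ℝ) * (C * Z * ((((m + 1 : ℕ) : ℝ)) ^ 4 * mT)) = 4 * K₀ * Z * mT := by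
    rw [e4, hC]; linear_combination (4 * K₀ * Z * mT) * hinv
  rw [e1, hZ]
  ring

/-- [folklore] **«G0-JET-MASS»: THE BLOCK MASSES OF THE ROAD's `Π_bm`-GAUGED PACKED FIRST JETS FROM BLOCK-TOTAL LETTERS — THE (M-b) SHAPE AT ANY IN-BLOCK ROOT**
(UNCONDITIONAL; the hybrid pin's `r := ctrOff 4 n` included): for
`0 ≤ σ ≤ κ′∕(16n)` and a first-jet pack `S` (fibre `Fib 3`) whose blocks have summable per-slot `u`-centred weighted masses and BLOCK-TOTAL letters
`Σ_{b ∈ box 4 n} Σ'_{(p,q)} Σ_{g f} |blk (S κ (n•y′ + b)) j k p q g f|·e^{σ(|p − (n•y′+b)|₁ + |q − (n•y′+b)|₁)} ≤ n⁴·m̄S j k` (every direction `κ`, every coarse block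
`y′`; `m̄S` = the slot-AVERAGED block mass in the table author's block units), every block of `vertexOfK (G₀^{bm} r) n S μ y` has centred weighted mass at
`n•y`, rate `σ`, summable and `≤ 4·C_{G₀}·e^{κ′∕2}·Zl 4 (κ′∕8) · m̄S j k` — the packed-vertex row of R-D1-g43-1 (M-b) at the road's own weights (PART 13's
`σV ∕ mV` currency on `Vroad` at a RAW pack), `mV j k := 4·C_{G₀}·e^{κ′∕2}·Zl 4 (κ′∕8)·m̄S j k` (POWER `n⁰`, k-free on the scales `n = Lc^k` when `m̄S` is). -/
theorem mass_blk_vertexOfK_G₀_le_of_blockTotal {S : Fin (3 + 1) → (Fin (3 + 1) → ℤ) → MKer 4 (Fib 3)} {σ : ℝ} {mS : Bool → Bool → ℝ}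
    (hσ0 : 0 ≤ σ) (hσ : σ ≤ kappa163 4 / 4 / (16 * ((m + 1 : ℕ) : ℝ)))
    (hSs : ∀ κ u j k, Summable fun p : Site 4 × Site 4 =>
      ∑ g, ∑ f, |blk (S κ u) j k p.1 p.2 g f| * Real.exp (σ * (l1 (p.1 - u) + l1 (p.2 - u))))
    (hSB : ∀ (κ : Fin (3 + 1)) (y' : Fin (3 + 1) → ℤ) (j k : Bool), ∑ b ∈ box (3 + 1) (m + 1),
      (∑' p : Site 4 × Site 4, ∑ g, ∑ f, |blk (S κ (((m + 1 : ℕ) : ℤ) • y' + toSite b)) j k p.1 p.2 g f|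
        * Real.exp (σ * (l1 (p.1 - (((m + 1 : ℕ) : ℤ) • y' + toSite b)) + l1 (p.2 - (((m + 1 : ℕ) : ℤ) • y' + toSite b)))))
      ≤ ((m + 1 : ℕ) : ℝ) ^ 4 * mS j k)
    (μ : Fin (3 + 1)) (y : Fin (3 + 1) → ℤ) (j k : Bool) :
    (Summable fun p : Site 4 × Site 4 => ∑ g, ∑ f,
        |blk (vertexOfK (coDressKBmAt (toSite r) (m + 1) (KInvStep (d := 3) (m + 1) 0)) (m + 1) S μ y) j k p.1 p.2 g f|
          * Real.exp (σ * (l1 (p.1 - ((m + 1 : ℕ) : ℤ) • y) + l1 (p.2 - ((m + 1 : ℕ) : ℤ) • y)))) ∧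
      ∑' p : Site 4 × Site 4, ∑ g, ∑ f,
          |blk (vertexOfK (coDressKBmAt (toSite r) (m + 1) (KInvStep (d := 3) (m + 1) 0)) (m + 1) S μ y) j k p.1 p.2 g f|
            * Real.exp (σ * (l1 (p.1 - ((m + 1 : ℕ) : ℤ) • y) + l1 (p.2 - ((m + 1 : ℕ) : ℤ) • y)))
        ≤ 4 * ((MG163 4 * periodConst (kappa163 4) 3) * (1 + 8 * (1 + Real.exp (kappa163 4 / 4))) * Real.exp (kappa163 4 / 4))
            * Real.exp (kappa163 4 / 4 / 2) * Zl 4 (kappa163 4 / 4 / 8) * mS j k := by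
  rw [blk_vertexOfK]
  exact mass_sum_wsum_colH_G₀_le_of_blockTotal m hr (T := fun κ u => blk (S κ u) j k) hσ0 hσ (fun κ u => hSs κ u j k)
    (fun κ y' => hSB κ y' j k) μ y

end Packed

end Summit.QuantumFields.BalabanUV.Beta.D1BFx.PackedColumnBlockTotalMass

end
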